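import Summits.NavierStokesRegularity.NavierStokesRegularity.Theorems.SqueezeCycleExtremalElementExists
import Summits.NavierStokesRegularity.NavierStokesRegularity.Theorems.ExtremalBiaxialitySubcritical.Negative.LoadBearing

/-!
# Crux `ExtremalBiaxialitySubcritical` (stmt-NavierStokesRegularity-11609), negative side:
# the maximality clause is logically free, and the kill shape is one point

Route `SqueezeCycle`, crux
`Summit.NavierStokesRegularity.NavierStokesRegularity.Theses.SqueezeCycle.ExtremalBiaxialitySubcritical`
(`∀ C m u t₀ x₀, t₀ < 0 → u ∈ 𝒦_C → [Λ_u(t₀,x₀) ≥ m] → [∀ v' ∈ 𝒦_C, Λ_{v'} ≤ m everywhere] →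
m < 1/8`, brackets in Courant–Fischer two-frame form, `Λ = (−t)λ₂(sym ∇u)` the Leray-gauge
middle strain eigenvalue, `lerayMiddleStrain`). Extracted from the crux work file
`Cruxes/ExtremalBiaxialitySubcritical/Disproof.lean` (cdisprove adversary, generation 3, D-0016);
companion of `Negative/LoadBearing` (generation 2), which showed that DROPPING the maximality clause
gives a statement sandwiched between the route target and `MustSqueeze → target`.

Generation 3 uses the now-PROVED compactness item `ExtremalElementExists`
(`exists_extremal_lerayMiddleStrain`, stmt-NavierStokesRegularity-11611, p70643: the class supremum
of `Λ` is attained as soon as it is exceeded by some `θ`) to settle the logical status of the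
maximality clause completely:

* `squeezeClass_mono` — `𝒦_C ⊆ 𝒦_{C'}` for `C ≤ C'`.
* `classMax_attained` — for EVERY `C ≥ 0` the class `𝒦_C` has an extremal element: some
  `u ∈ 𝒦_C` and `m ≥ 0` with `Λ_u(−1,0) ≥ m` and `Λ ≤ m` on all of `𝒦_C` (both clauses of the
  crux, verbatim). The crux's hypotheses are therefore satisfied, for every `C ≥ 0`, by a genuine
  maximiser with `m = max_{𝒦_C} Λ`; the crux is the assertion `max_{𝒦_C} Λ < 1/8` for all `C`.
* `lerayMiddleStrain_lt_of_crux`, `withoutMaximality_of_crux`, `crux_iff_withoutMaximality`,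
  `crux_iff_forall_lerayMiddleStrain_lt` — **maximality is free**: the crux is EQUIVALENT to the
  same statement with the maximality clause deleted, i.e. to the pointwise a-priori bound
  "`Λ_u(t,x) < 1/8` at every point of every element of every `𝒦_C`". Assuming the extremal
  element is a legitimate proof device (Kenig–Merle style), but it adds no logical strength, and
  no generality is lost by a prover who ignores it; conversely nothing is gained by a disprover
  from it: see the next item.
* `not_crux_iff_exists_point`, `not_crux_iff_eventually` — **kill shape without maximality**: the
  crux fails iff SOME element of SOME `𝒦_C` has `Λ ≥ 1/8` at ONE point `(t,x)`, `t < 0` (lower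
  two-frame clause at `m = 1/8`), equivalently iff this happens in `𝒦_C` for all large `C`.
  No extremal element, no comparison over the class is needed for a refutation — and none is
  available: such an element is a nontrivial Type-I ancient KNSS-mild solution (open Liouville
  problem; `Negative/LoadBearing`, tree `…SmallConstant`, `…Symmetric`).
* `classMax_gap`, `crux_iff_forall_lerayMiddleStrain_lt_quarter` — with the `MustSqueeze` family
  below `1/4` (the sibling crux's engine, hypothesis `hMS` exactly as in the tree's
  `extremalBiaxialitySubcritical_bootstrap`): every attained class maximum satisfies
  `m ≤ 0 ∨ 1/4 ≤ m` (spectral gap `(0, 1/4)` for `max_{𝒦_C} Λ`), and the crux is equivalent to the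
  pointwise bound `Λ < 1/4` on every `𝒦_C` — the threshold `1/8` carries no content.
-/

noncomputable section

open Set Function Filter MeasureTheory
open scoped RealInnerProductSpace

namespace Summit.NavierStokesRegularity.NavierStokesRegularity.Theorems.ExtremalBiaxialitySubcritical.Negative

open Literature.Analysis.FluidPDE
open Summit.NavierStokesRegularity.NavierStokesRegularity.Theses

/-! ### Monotonicity of the class in the constant -/

/-- **`𝒦_C ⊆ 𝒦_{C'}` for `C ≤ C'`**: the Type-I rate and the two scaled-energy bounds are the
only clauses mentioning the constant, and they are upper bounds. [folklore] -/
theorem squeezeClass_mono {C C' : ℝ} (hCC' : C ≤ C') {u : ℝ → EuclideanSpace ℝ (Fin 3) → EuclideanSpace ℝ (Fin 3)}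
    (hu : ContDiffOn ℝ (⊤ : ℕ∞) (Function.uncurry u) (Set.Iio 0 ×ˢ Set.univ) ∧ (∀ t < 0, Literature.Analysis.FluidPDE.VectorCalculus.IsDivFree (u t)) ∧ (∀ s t : ℝ, s < t → t < 0 → ∀ x, u t x = Literature.Analysis.FluidPDE.heatFlow (u s) (t-s) x - ∫ τ in Set.Ioo s t, ∫ y, ((-(inner ℝ (x-y) (u τ y) / (2*(t-τ)) * Literature.Analysis.UnboundedOperators.heatKernel (t-τ) (x-y))) • u τ y + (∫ σ in Set.Ioi (t-τ), Literature.Analysis.UnboundedOperators.heatKernel σ (x-y) / (4*σ^2)) • (inner ℝ (x-y) (u τ y) • u τ y + inner ℝ (u τ y) (u τ y) • (x-y) + inner ℝ (x-y) (u τ y) • u τ y) - ((∫ σ in Set.Ioi (t-τ), Literature.Analysis.UnboundedOperators.heatKernel σ (x-y) / (8*σ^3)) * (inner ℝ (x-y) (u τ y) * inner ℝ (x-y) (u τ y))) • (x-y))) ∧ Literature.Analysis.FluidPDE.HasTypeITimeDecay C u ∧ (∀ (x₀ : EuclideanSpace ℝ (Fin 3)) (t₀ r : ℝ), t₀ ≤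 0 → 0 < r → (∀ t, t₀ - r^2 < t → t < t₀ → r⁻¹ * ∫ x in Metric.ball x₀ r, ‖u t x‖^2 ≤ C) ∧ r⁻¹ * ∫ t in Set.Ioo (t₀ - r^2) t₀, ∫ x in Metric.ball x₀ r, ‖fderiv ℝ (u t) x‖^2 ≤ C)) :
    ContDiffOn ℝ (⊤ : ℕ∞) (Function.uncurry u) (Set.Iio 0 ×ˢ Set.univ) ∧ (∀ t < 0, Literature.Analysis.FluidPDE.VectorCalculus.IsDivFree (u t)) ∧ (∀ s t : ℝ, s < t → t < 0 → ∀ x, u t x = Literature.Analysis.FluidPDE.heatFlow (u s) (t-s) x - ∫ τ in Set.Ioo s t, ∫ y, ((-(inner ℝ (x-y) (u τ y) / (2*(t-τ)) * Literature.Analysis.UnboundedOperators.heatKernel (t-τ) (x-y))) • u τ y + (∫ σ in Set.Ioi (t-τ), Literature.Analysis.UnboundedOperators.heatKernel σ (x-y) / (4*σ^2)) • (inner ℝ (x-y) (u τ y) • u τ y + inner ℝ (u τ y) (u τ y) • (x-y) + inner ℝ (x-y) (u τ y) • u τ y) - ((∫ σ in Set.Ioi (t-τ), Literature.Analysis.UnboundedOperators.heatKernel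 σ (x-y) / (8*σ^3)) * (inner ℝ (x-y) (u τ y) * inner ℝ (x-y) (u τ y))) • (x-y))) ∧ Literature.Analysis.FluidPDE.HasTypeITimeDecay C' u ∧ (∀ (x₀ : EuclideanSpace ℝ (Fin 3)) (t₀ r : ℝ), t₀ ≤ 0 → 0 < r → (∀ t, t₀ - r^2 < t → t < t₀ → r⁻¹ * ∫ x in Metric.ball x₀ r, ‖u t x‖^2 ≤ C') ∧ r⁻¹ * ∫ t in Set.Ioo (t₀ - r^2) t₀, ∫ x in Metric.ball x₀ r, ‖fderiv ℝ (u t) x‖^2 ≤ C') := by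
  obtain ⟨h1, h2, h3, h4, h5⟩ := hu
  refine ⟨h1, h2, h3, fun t ht x => (h4 t ht x).trans ?_, fun x₀ t₀ r ht₀ hr => ?_⟩
  · exact div_le_div_of_nonneg_right hCC' (Real.sqrt_nonneg _)
  · obtain ⟨hA, hE⟩ := h5 x₀ t₀ r ht₀ hr
    exact ⟨fun t h1t h2t => (hA t h1t h2t).trans hCC', hE.trans hCC'⟩

/-! ### The class maximum is always attained -/

/-- The zero field has Leray-gauge middle strain eigenvalue `≥ 0` (indeed `= 0`) at every
`t < 0` (zero gradient; frame `(e₀, e₁)`). [folklore] -/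
theorem lerayMiddleStrain_zero_nonneg {t : ℝ} (ht : t < 0) (x : EuclideanSpace ℝ (Fin 3)) :
    0 ≤ lerayMiddleStrain (0 : ℝ → EuclideanSpace ℝ (Fin 3) → EuclideanSpace ℝ (Fin 3)) t x := by
  refine (le_lerayMiddleStrain_iff ht 0).2 ⟨EuclideanSpace.single 0 1, EuclideanSpace.single 1 1,
    by simp, by simp, by simp [EuclideanSpace.inner_single_left], fun α β => ?_⟩
  simp

/-- **Extremal elements exist unconditionally.** For every `C ≥ 0` there are `u ∈ 𝒦_C` and
`m ≥ 0` such that `Λ_u(−1, 0) ≥ m` (the crux's attainment clause, verbatim, at `(t₀,x₀) = (−1,0)`)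
and `Λ_{v'}(t,x) ≤ m` for every `v' ∈ 𝒦_C`, `t < 0`, `x` (the crux's maximality clause, verbatim):
`m = max_{𝒦_C} Λ` is attained. Proof: the tree's `exists_extremal_lerayMiddleStrain` (KNSS
compactness, item `ExtremalElementExists`, PROVED) applied to `0 ∈ 𝒦_C` with `θ = −1 < 0 ≤ Λ_0`;
`m ≥ 0` by testing maximality on `0`. Hence the hypotheses of the crux are satisfiable for every
`C ≥ 0` by a genuine maximiser, and the crux is the statement `max_{𝒦_C} Λ < 1/8 ∀ C`. [folklore] -/
theorem classMax_attained {C : ℝ} (hC : 0 ≤ C) :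
    ∃ (u : ℝ → EuclideanSpace ℝ (Fin 3) → EuclideanSpace ℝ (Fin 3)) (m : ℝ), 0 ≤ m ∧ (ContDiffOn ℝ (⊤ : ℕ∞) (Function.uncurry u) (Set.Iio 0 ×ˢ Set.univ) ∧ (∀ t < 0, Literature.Analysis.FluidPDE.VectorCalculus.IsDivFree (u t)) ∧ (∀ s t : ℝ, s < t → t < 0 → ∀ x, u t x = Literature.Analysis.FluidPDE.heatFlow (u s) (t-s) x - ∫ τ in Set.Ioo s t, ∫ y, ((-(inner ℝ (x-y) (u τ y) / (2*(t-τ)) * Literature.Analysis.UnboundedOperators.heatKernel (t-τ) (x-y))) • u τ y + (∫ σ in Set.Ioi (t-τ), Literature.Analysis.UnboundedOperators.heatKernel σ (x-y) / (4*σ^2)) • (inner ℝ (x-y) (u τ y) • u τ y + inner ℝ (u τ y) (u τ y) • (x-y) + inner ℝ (x-y) (u τ y) • u τ y) - ((∫ σ in Set.Ioi (t-τ), Literature.Analysis.UnboundedOperators.heatKernel σ (x-y) / (8*σ^3)) * (inner ℝ (x-y) (u τ y) * inner ℝ (x-y) (u τ y))) • (x-y))) ∧ Literature.Analysis.FluidPDE.HasTypeITimeDecay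 C u ∧ (∀ (x₀ : EuclideanSpace ℝ (Fin 3)) (t₀ r : ℝ), t₀ ≤ 0 → 0 < r → (∀ t, t₀ - r^2 < t → t < t₀ → r⁻¹ * ∫ x in Metric.ball x₀ r, ‖u t x‖^2 ≤ C) ∧ r⁻¹ * ∫ t in Set.Ioo (t₀ - r^2) t₀, ∫ x in Metric.ball x₀ r, ‖fderiv ℝ (u t) x‖^2 ≤ C)) ∧
      (∃ v w : EuclideanSpace ℝ (Fin 3), ‖v‖ = 1 ∧ ‖w‖ = 1 ∧ inner ℝ v w = 0 ∧ ∀ α β : ℝ, m * (α^2 + β^2) ≤ (-(-1 : ℝ)) * inner ℝ (fderiv ℝ (u (-1 : ℝ)) 0 (α • v + β • w)) (α • v + β • w)) ∧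
      (∀ v' : ℝ → EuclideanSpace ℝ (Fin 3) → EuclideanSpace ℝ (Fin 3), ContDiffOn ℝ (⊤ : ℕ∞) (Function.uncurry v') (Set.Iio 0 ×ˢ Set.univ) ∧ (∀ t < 0, Literature.Analysis.FluidPDE.VectorCalculus.IsDivFree (v' t)) ∧ (∀ s t : ℝ, s < t → t < 0 → ∀ x, v' t x = Literature.Analysis.FluidPDE.heatFlow (v' s) (t-s) x - ∫ τ in Set.Ioo s t, ∫ y, ((-(inner ℝ (x-y) (v' τ y) / (2*(t-τ)) * Literature.Analysis.UnboundedOperators.heatKernel (t-τ) (x-y))) • v' τ y + (∫ σ in Set.Ioi (t-τ), Literature.Analysis.UnboundedOperators.heatKernel σ (x-y) / (4*σ^2)) • (inner ℝ (x-y) (v' τ y) • v' τ y + inner ℝ (v' τ y) (v' τ y) • (x-y) + inner ℝ (x-y) (v' τ y) • v' τ y) - ((∫ σ in Set.Ioi (t-τ), Literature.Analysis.UnboundedOperators.heatKernel σ (x-y) / (8*σ^3)) * (inner ℝ (x-y) (v' τ y) * inner ℝ (x-y) (v' τ y))) • (x-y))) ∧ Literature.Analysis.FluidPDE.HasTypeITimeDecay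 C v' ∧ (∀ (x₀ : EuclideanSpace ℝ (Fin 3)) (t₀ r : ℝ), t₀ ≤ 0 → 0 < r → (∀ t, t₀ - r^2 < t → t < t₀ → r⁻¹ * ∫ x in Metric.ball x₀ r, ‖v' t x‖^2 ≤ C) ∧ r⁻¹ * ∫ t in Set.Ioo (t₀ - r^2) t₀, ∫ x in Metric.ball x₀ r, ‖fderiv ℝ (v' t) x‖^2 ≤ C) → ∀ t < 0, ∀ x, (∃ v w : EuclideanSpace ℝ (Fin 3), ‖v‖ = 1 ∧ ‖w‖ = 1 ∧ inner ℝ v w = 0 ∧ ∀ α β : ℝ, (-t) * inner ℝ (fderiv ℝ (v' t) x (α • v + β • w)) (α • v + β • w) ≤ m * (α^2 + β^2))) := by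
  have hu₀ : IsTypeIAncientMild C (0 : ℝ → EuclideanSpace ℝ (Fin 3) → EuclideanSpace ℝ (Fin 3)) := isTypeIAncientMild_zero hC
  have hen₀ := (squeezeClass_zero hC).2.2.2.2
  have hθ : (-1 : ℝ) < lerayMiddleStrain (0 : ℝ → EuclideanSpace ℝ (Fin 3) → EuclideanSpace ℝ (Fin 3)) (-1) 0 :=
    lt_of_lt_of_le (by norm_num) (lerayMiddleStrain_zero_nonneg (by norm_num) 0)
  obtain ⟨u', hu'c, hu'e, m, -, hmW, hmax⟩ :=
    exists_extremal_lerayMiddleStrain C hu₀ hen₀ (by norm_num : (-1 : ℝ) < 0) (x₁ := 0) hθ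
  have hm0 : 0 ≤ m :=
    (lerayMiddleStrain_zero_nonneg (by norm_num : (-1 : ℝ) < 0) 0).trans
      (hmax 0 hu₀ hen₀ (-1) (by norm_num) 0)
  obtain ⟨hsm', hdiv', hmild', hI'⟩ := isTypeIAncientMild_iff.1 hu'c
  refine ⟨u', m, hm0, ⟨hsm', hdiv', hmild', hI', hu'e⟩,
    (le_lerayMiddleStrain_iff (by norm_num : (-1 : ℝ) < 0) m).1 hmW, ?_⟩
  rintro v' ⟨hvsm, hvdiv, hvmild, hvI, hve⟩ t ht x
  exact (lerayMiddleStrain_le_iff ht m).1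
    (hmax v' (isTypeIAncientMild_iff.2 ⟨hvsm, hvdiv, hvmild, hvI⟩) hve t ht x)

/-! ### Under the crux: strict pointwise subcriticality — maximality is free -/

/-- **The crux forces `Λ < 1/8` at EVERY point of EVERY element of EVERY `𝒦_C`.** If
`Λ_u(t,x) ≥ 1/8` somewhere, the attained class maximum `m` (`exists_extremal_lerayMiddleStrain`
with `θ = Λ_u(t,x) − 1`) satisfies `m ≥ Λ_u(t,x) ≥ 1/8`, and the crux applied to the maximiser
at `(−1, 0)` gives `m < 1/8`. [folklore] -/
theorem lerayMiddleStrain_lt_of_crux (hX : SqueezeCycle.ExtremalBiaxialitySubcritical) {C : ℝ}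
    {u : ℝ → EuclideanSpace ℝ (Fin 3) → EuclideanSpace ℝ (Fin 3)}
    (hu : ContDiffOn ℝ (⊤ : ℕ∞) (Function.uncurry u) (Set.Iio 0 ×ˢ Set.univ) ∧ (∀ t < 0, Literature.Analysis.FluidPDE.VectorCalculus.IsDivFree (u t)) ∧ (∀ s t : ℝ, s < t → t < 0 → ∀ x, u t x = Literature.Analysis.FluidPDE.heatFlow (u s) (t-s) x - ∫ τ in Set.Ioo s t, ∫ y, ((-(inner ℝ (x-y) (u τ y) / (2*(t-τ)) * Literature.Analysis.UnboundedOperators.heatKernel (t-τ) (x-y))) • u τ y + (∫ σ in Set.Ioi (t-τ), Literature.Analysis.UnboundedOperators.heatKernel σ (x-y) / (4*σ^2)) • (inner ℝ (x-y) (u τ y) • u τ y + inner ℝ (u τ y) (u τ y) • (x-y) + inner ℝ (x-y) (u τ y) • u τ y) - ((∫ σ in Set.Ioi (t-τ), Literature.Analysis.UnboundedOperators.heatKernel σ (x-y) / (8*σ^3)) * (inner ℝ (x-y) (u τ y) * inner ℝ (x-y) (u τ y))) • (x-y))) ∧ Literature.Analysis.FluidPDE.HasTypeITimeDecay C u ∧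 (∀ (x₀ : EuclideanSpace ℝ (Fin 3)) (t₀ r : ℝ), t₀ ≤ 0 → 0 < r → (∀ t, t₀ - r^2 < t → t < t₀ → r⁻¹ * ∫ x in Metric.ball x₀ r, ‖u t x‖^2 ≤ C) ∧ r⁻¹ * ∫ t in Set.Ioo (t₀ - r^2) t₀, ∫ x in Metric.ball x₀ r, ‖fderiv ℝ (u t) x‖^2 ≤ C))
    {t : ℝ} (ht : t < 0) (x : EuclideanSpace ℝ (Fin 3)) :
    lerayMiddleStrain u t x < 1 / 8 := by
  by_contra hge
  rw [not_lt] at hge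
  obtain ⟨hsm, hdiv, hmild, hI, hen⟩ := hu
  have hu' : IsTypeIAncientMild C u := isTypeIAncientMild_iff.2 ⟨hsm, hdiv, hmild, hI⟩
  obtain ⟨u', hu'c, hu'e, m, -, hmW, hmax⟩ :=
    exists_extremal_lerayMiddleStrain C hu' hen ht (x₁ := x) (θ := lerayMiddleStrain u t x - 1)
      (by linarith)
  have hm : 1 / 8 ≤ m := hge.trans (hmax u hu' hen t ht x)
  obtain ⟨hsm', hdiv', hmild', hI'⟩ := isTypeIAncientMild_iff.1 hu'c
  have hlt : m < 1 / 8 :=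
    hX C m u' (-1) 0 (by norm_num) ⟨hsm', hdiv', hmild', hI', hu'e⟩
      ((le_lerayMiddleStrain_iff (by norm_num) m).1 hmW)
      (fun v' hv' s hs y => by
        obtain ⟨hvsm, hvdiv, hvmild, hvI, hve⟩ := hv'
        exact (lerayMiddleStrain_le_iff hs m).1
          (hmax v' (isTypeIAncientMild_iff.2 ⟨hvsm, hvdiv, hvmild, hvI⟩) hve s hs y))
  linarith

/-- **`crux ⇒ WithoutMaximality`**: the crux implies the same statement with its maximality
clause deleted ("an attained value `m ≤ Λ_u(t₀,x₀)` of any element is `< 1/8`"). [folklore] -/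
theorem withoutMaximality_of_crux (hX : SqueezeCycle.ExtremalBiaxialitySubcritical) :
    ∀ (C m : ℝ) (u : ℝ → EuclideanSpace ℝ (Fin 3) → EuclideanSpace ℝ (Fin 3)) (t₀ : ℝ) (x₀ : EuclideanSpace ℝ (Fin 3)), t₀ < 0 → (ContDiffOn ℝ (⊤ : ℕ∞) (Function.uncurry u) (Set.Iio 0 ×ˢ Set.univ) ∧ (∀ t < 0, Literature.Analysis.FluidPDE.VectorCalculus.IsDivFree (u t)) ∧ (∀ s t : ℝ, s < t → t < 0 → ∀ x, u t x = Literature.Analysis.FluidPDE.heatFlow (u s) (t-s) x - ∫ τ in Set.Ioo s t, ∫ y, ((-(inner ℝ (x-y) (u τ y) / (2*(t-τ)) * Literature.Analysis.UnboundedOperators.heatKernel (t-τ) (x-y))) • u τ y + (∫ σ in Set.Ioi (t-τ), Literature.Analysis.UnboundedOperators.heatKernel σ (x-y) / (4*σ^2)) • (inner ℝ (x-y) (u τ y) • u τ y + inner ℝ (u τ y) (u τ y) • (x-y) + inner ℝ (x-y) (u τ y) • u τ y) - ((∫ σ in Set.Ioi (t-τ), Literature.Analysis.UnboundedOperators.heatKernel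 σ (x-y) / (8*σ^3)) * (inner ℝ (x-y) (u τ y) * inner ℝ (x-y) (u τ y))) • (x-y))) ∧ Literature.Analysis.FluidPDE.HasTypeITimeDecay C u ∧ (∀ (x₀ : EuclideanSpace ℝ (Fin 3)) (t₀ r : ℝ), t₀ ≤ 0 → 0 < r → (∀ t, t₀ - r^2 < t → t < t₀ → r⁻¹ * ∫ x in Metric.ball x₀ r, ‖u t x‖^2 ≤ C) ∧ r⁻¹ * ∫ t in Set.Ioo (t₀ - r^2) t₀, ∫ x in Metric.ball x₀ r, ‖fderiv ℝ (u t) x‖^2 ≤ C)) → (∃ v w : EuclideanSpace ℝ (Fin 3), ‖v‖ = 1 ∧ ‖w‖ = 1 ∧ inner ℝ v w = 0 ∧ ∀ α β : ℝ, m * (α^2 + β^2) ≤ (-t₀) * inner ℝ (fderiv ℝ (u t₀) x₀ (α • v + β • w)) (α • v + β • w)) → m < 1 / 8 := by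
  intro C m u t₀ x₀ ht₀ hu hGE
  have h1 : m ≤ lerayMiddleStrain u t₀ x₀ := (le_lerayMiddleStrain_iff ht₀ m).2 hGE
  have h2 := lerayMiddleStrain_lt_of_crux hX hu ht₀ x₀
  linarith

/-- **Maximality is free**: the crux is EQUIVALENT to the statement obtained by deleting its
maximality clause (generation 2 showed the latter is sandwiched between `SqueezeLiouville` and
`MustSqueeze → SqueezeLiouville`; with `ExtremalElementExists` proved the sandwich closes on the
crux side). [folklore] -/
theorem crux_iff_withoutMaximality :
    SqueezeCycle.ExtremalBiaxialitySubcritical ↔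
      ∀ (C m : ℝ) (u : ℝ → EuclideanSpace ℝ (Fin 3) → EuclideanSpace ℝ (Fin 3)) (t₀ : ℝ) (x₀ : EuclideanSpace ℝ (Fin 3)), t₀ < 0 → (ContDiffOn ℝ (⊤ : ℕ∞) (Function.uncurry u) (Set.Iio 0 ×ˢ Set.univ) ∧ (∀ t < 0, Literature.Analysis.FluidPDE.VectorCalculus.IsDivFree (u t)) ∧ (∀ s t : ℝ, s < t → t < 0 → ∀ x, u t x = Literature.Analysis.FluidPDE.heatFlow (u s) (t-s) x - ∫ τ in Set.Ioo s t, ∫ y, ((-(inner ℝ (x-y) (u τ y) / (2*(t-τ)) * Literature.Analysis.UnboundedOperators.heatKernel (t-τ) (x-y))) • u τ y + (∫ σ in Set.Ioi (t-τ), Literature.Analysis.UnboundedOperators.heatKernel σ (x-y) / (4*σ^2)) • (inner ℝ (x-y) (u τ y) • u τ y + inner ℝ (u τ y) (u τ y) • (x-y) + inner ℝ (x-y) (u τ y) • u τ y) - ((∫ σ in Set.Ioi (t-τ), Literature.Analysis.UnboundedOperators.heatKernel σ (x-y) / (8*σ^3)) * (inner ℝ (x-y) (u τ y) * inner ℝ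 (x-y) (u τ y))) • (x-y))) ∧ Literature.Analysis.FluidPDE.HasTypeITimeDecay C u ∧ (∀ (x₀ : EuclideanSpace ℝ (Fin 3)) (t₀ r : ℝ), t₀ ≤ 0 → 0 < r → (∀ t, t₀ - r^2 < t → t < t₀ → r⁻¹ * ∫ x in Metric.ball x₀ r, ‖u t x‖^2 ≤ C) ∧ r⁻¹ * ∫ t in Set.Ioo (t₀ - r^2) t₀, ∫ x in Metric.ball x₀ r, ‖fderiv ℝ (u t) x‖^2 ≤ C)) → (∃ v w : EuclideanSpace ℝ (Fin 3), ‖v‖ = 1 ∧ ‖w‖ = 1 ∧ inner ℝ v w = 0 ∧ ∀ α β : ℝ, m * (α^2 + β^2) ≤ (-t₀) * inner ℝ (fderiv ℝ (u t₀) x₀ (α • v + β • w)) (α • v + β • w)) → m < 1 / 8 :=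
  ⟨withoutMaximality_of_crux, fun hW C m u t₀ x₀ ht₀ hu hGE _ => hW C m u t₀ x₀ ht₀ hu hGE⟩

/-- **The crux as an a-priori bound**: `ExtremalBiaxialitySubcritical` holds iff the Leray-gauge
middle strain eigenvalue of every element of every Type-I model class is `< 1/8` at every point
of `ℝ³ × (−∞, 0)`. [folklore] -/
theorem crux_iff_forall_lerayMiddleStrain_lt :
    SqueezeCycle.ExtremalBiaxialitySubcritical ↔
      ∀ (C : ℝ) (u : ℝ → EuclideanSpace ℝ (Fin 3) → EuclideanSpace ℝ (Fin 3)), (ContDiffOn ℝ (⊤ : ℕ∞) (Function.uncurry u) (Set.Iio 0 ×ˢ Set.univ) ∧ (∀ t < 0, Literature.Analysis.FluidPDE.VectorCalculus.IsDivFree (u t)) ∧ (∀ s t : ℝ, s < t → t < 0 → ∀ x, u t x = Literature.Analysis.FluidPDE.heatFlow (u s) (t-s) x - ∫ τ in Set.Ioo s t, ∫ y, ((-(inner ℝ (x-y) (u τ y) / (2*(t-τ)) * Literature.Analysis.UnboundedOperators.heatKernel (t-τ) (x-y))) • u τ y + (∫ σ in Set.Ioi (t-τ), Literature.Analysis.UnboundedOperators.heatKernel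 σ (x-y) / (4*σ^2)) • (inner ℝ (x-y) (u τ y) • u τ y + inner ℝ (u τ y) (u τ y) • (x-y) + inner ℝ (x-y) (u τ y) • u τ y) - ((∫ σ in Set.Ioi (t-τ), Literature.Analysis.UnboundedOperators.heatKernel σ (x-y) / (8*σ^3)) * (inner ℝ (x-y) (u τ y) * inner ℝ (x-y) (u τ y))) • (x-y))) ∧ Literature.Analysis.FluidPDE.HasTypeITimeDecay C u ∧ (∀ (x₀ : EuclideanSpace ℝ (Fin 3)) (t₀ r : ℝ), t₀ ≤ 0 → 0 < r → (∀ t, t₀ - r^2 < t → t < t₀ → r⁻¹ * ∫ x in Metric.ball x₀ r, ‖u t x‖^2 ≤ C) ∧ r⁻¹ * ∫ t in Set.Ioo (t₀ - r^2) t₀, ∫ x in Metric.ball x₀ r, ‖fderiv ℝ (u t) x‖^2 ≤ C)) →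
        ∀ t < 0, ∀ x, lerayMiddleStrain u t x < 1 / 8 :=
  ⟨fun hX _ _ hu _ ht x => lerayMiddleStrain_lt_of_crux hX hu ht x,
    fun h C m u t₀ x₀ ht₀ hu hGE _ =>
      lt_of_le_of_lt ((le_lerayMiddleStrain_iff ht₀ m).2 hGE) (h C u hu t₀ ht₀ x₀)⟩

/-! ### Kill shape without maximality -/

/-- **Kill shape, point form.** The crux fails iff some element of some `𝒦_C` satisfies the
lower two-frame clause with `m = 1/8` at ONE point `(t, x)`, `t < 0` — i.e. `Λ_u(t,x) ≥ 1/8`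
somewhere. (Such a `u` is a nontrivial Type-I ancient KNSS-mild solution.) [folklore] -/
theorem not_crux_iff_exists_point :
    ¬ SqueezeCycle.ExtremalBiaxialitySubcritical ↔
      ∃ (C : ℝ) (u : ℝ → EuclideanSpace ℝ (Fin 3) → EuclideanSpace ℝ (Fin 3)) (t : ℝ) (x : EuclideanSpace ℝ (Fin 3)), t < 0 ∧ (ContDiffOn ℝ (⊤ : ℕ∞) (Function.uncurry u) (Set.Iio 0 ×ˢ Set.univ) ∧ (∀ t < 0, Literature.Analysis.FluidPDE.VectorCalculus.IsDivFree (u t)) ∧ (∀ s t : ℝ, s < t → t < 0 → ∀ x, u t x = Literature.Analysis.FluidPDE.heatFlow (u s) (t-s) x - ∫ τ in Set.Ioo s t, ∫ y, ((-(inner ℝ (x-y) (u τ y) / (2*(t-τ)) * Literature.Analysis.UnboundedOperators.heatKernel (t-τ) (x-y))) • u τ y + (∫ σ in Set.Ioi (t-τ), Literature.Analysis.UnboundedOperators.heatKernel σ (x-y) / (4*σ^2)) • (inner ℝ (x-y) (u τ y) • u τ y + inner ℝ (u τ y) (u τ y) • (x-y) + inner ℝ (x-y) (u τ y) • u τ y)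 - ((∫ σ in Set.Ioi (t-τ), Literature.Analysis.UnboundedOperators.heatKernel σ (x-y) / (8*σ^3)) * (inner ℝ (x-y) (u τ y) * inner ℝ (x-y) (u τ y))) • (x-y))) ∧ Literature.Analysis.FluidPDE.HasTypeITimeDecay C u ∧ (∀ (x₀ : EuclideanSpace ℝ (Fin 3)) (t₀ r : ℝ), t₀ ≤ 0 → 0 < r → (∀ t, t₀ - r^2 < t → t < t₀ → r⁻¹ * ∫ x in Metric.ball x₀ r, ‖u t x‖^2 ≤ C) ∧ r⁻¹ * ∫ t in Set.Ioo (t₀ - r^2) t₀, ∫ x in Metric.ball x₀ r, ‖fderiv ℝ (u t) x‖^2 ≤ C)) ∧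
        (∃ v w : EuclideanSpace ℝ (Fin 3), ‖v‖ = 1 ∧ ‖w‖ = 1 ∧ inner ℝ v w = 0 ∧ ∀ α β : ℝ, (1 / 8 : ℝ) * (α^2 + β^2) ≤ (-t) * inner ℝ (fderiv ℝ (u t) x (α • v + β • w)) (α • v + β • w)) := by
  rw [crux_iff_forall_lerayMiddleStrain_lt]
  constructor
  · intro h
    push Not at h
    obtain ⟨C, u, hu, t, ht, x, hx⟩ := h
    exact ⟨C, u, t, x, ht, hu, (le_lerayMiddleStrain_iff ht _).1 hx⟩
  · rintro ⟨C, u, t, x, ht, hu, hx⟩ h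
    exact not_le.2 (h C u hu t ht x) ((le_lerayMiddleStrain_iff ht _).2 hx)

/-- **Kill shape, eventual form.** The crux fails iff for all sufficiently large constants `C`
the class `𝒦_C` contains an element with `Λ ≥ 1/8` at some point (`squeezeClass_mono`). [folklore] -/
theorem not_crux_iff_eventually :
    ¬ SqueezeCycle.ExtremalBiaxialitySubcritical ↔
      ∃ C₀ : ℝ, ∀ C : ℝ, C₀ ≤ C → ∃ (u : ℝ → EuclideanSpace ℝ (Fin 3) → EuclideanSpace ℝ (Fin 3)) (t : ℝ) (x : EuclideanSpace ℝ (Fin 3)), t < 0 ∧ (ContDiffOn ℝ (⊤ : ℕ∞) (Function.uncurry u) (Set.Iio 0 ×ˢ Set.univ) ∧ (∀ t < 0, Literature.Analysis.FluidPDE.VectorCalculus.IsDivFree (u t)) ∧ (∀ s t : ℝ, s < t → t < 0 → ∀ x, u t x = Literature.Analysis.FluidPDE.heatFlow (u s) (t-s) x - ∫ τ in Set.Ioo s t, ∫ y, ((-(inner ℝ (x-y) (u τ y) / (2*(t-τ)) * Literature.Analysis.UnboundedOperators.heatKernel (t-τ) (x-y))) • u τ y + (∫ σ in Set.Ioi (t-τ),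 Literature.Analysis.UnboundedOperators.heatKernel σ (x-y) / (4*σ^2)) • (inner ℝ (x-y) (u τ y) • u τ y + inner ℝ (u τ y) (u τ y) • (x-y) + inner ℝ (x-y) (u τ y) • u τ y) - ((∫ σ in Set.Ioi (t-τ), Literature.Analysis.UnboundedOperators.heatKernel σ (x-y) / (8*σ^3)) * (inner ℝ (x-y) (u τ y) * inner ℝ (x-y) (u τ y))) • (x-y))) ∧ Literature.Analysis.FluidPDE.HasTypeITimeDecay C u ∧ (∀ (x₀ : EuclideanSpace ℝ (Fin 3)) (t₀ r : ℝ), t₀ ≤ 0 → 0 < r → (∀ t, t₀ - r^2 < t → t < t₀ → r⁻¹ * ∫ x in Metric.ball x₀ r, ‖u t x‖^2 ≤ C) ∧ r⁻¹ * ∫ t in Set.Ioo (t₀ - r^2) t₀, ∫ x in Metric.ball x₀ r, ‖fderiv ℝ (u t) x‖^2 ≤ C)) ∧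
        (∃ v w : EuclideanSpace ℝ (Fin 3), ‖v‖ = 1 ∧ ‖w‖ = 1 ∧ inner ℝ v w = 0 ∧ ∀ α β : ℝ, (1 / 8 : ℝ) * (α^2 + β^2) ≤ (-t) * inner ℝ (fderiv ℝ (u t) x (α • v + β • w)) (α • v + β • w)) := by
  rw [not_crux_iff_exists_point]
  constructor
  · rintro ⟨C, u, t, x, ht, hu, hx⟩
    exact ⟨C, fun C' hC' => ⟨u, t, x, ht, squeezeClass_mono hC' hu, hx⟩⟩
  · rintro ⟨C₀, h⟩
    obtain ⟨u, t, x, ht, hu, hx⟩ := h C₀ le_rfl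
    exact ⟨C₀, u, t, x, ht, hu, hx⟩

/-! ### With the `MustSqueeze` family: the spectral gap `(0, 1/4)` and the quarter form -/

/-- **Spectral gap for attained class maxima.** Given the `MustSqueeze` family for every
threshold `a < 1/4` (hypothesis `hMS`, exactly as in `extremalBiaxialitySubcritical_bootstrap`),
an attained class-wide maximum `m` of `Λ` over `𝒦_C` satisfies `m ≤ 0 ∨ 1/4 ≤ m`: if `m < 1/4`,
`MustSqueeze_m` applies to the maximiser itself, which vanishes, so `m ≤ 0`. With
`classMax_attained`: `max_{𝒦_C} Λ ∈ {0} ∪ [1/4, ∞)` for every `C ≥ 0`. [folklore] -/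
theorem classMax_gap
    (hMS : ∀ a : ℝ, a < 1 / 4 → ∀ (C : ℝ) (u : ℝ → EuclideanSpace ℝ (Fin 3) → EuclideanSpace ℝ (Fin 3)), ContDiffOn ℝ (⊤ : ℕ∞) (Function.uncurry u) (Set.Iio 0 ×ˢ Set.univ) ∧ (∀ t < 0, Literature.Analysis.FluidPDE.VectorCalculus.IsDivFree (u t)) ∧ (∀ s t : ℝ, s < t → t < 0 → ∀ x, u t x = Literature.Analysis.FluidPDE.heatFlow (u s) (t-s) x - ∫ τ in Set.Ioo s t, ∫ y, ((-(inner ℝ (x-y) (u τ y) / (2*(t-τ)) * Literature.Analysis.UnboundedOperators.heatKernel (t-τ) (x-y))) • u τ y + (∫ σ in Set.Ioi (t-τ), Literature.Analysis.UnboundedOperators.heatKernel σ (x-y) / (4*σ^2)) • (inner ℝ (x-y) (u τ y) • u τ y + inner ℝ (u τ y) (u τ y) • (x-y) + inner ℝ (x-y) (u τ y) • u τ y) - ((∫ σ in Set.Ioi (t-τ), Literature.Analysis.UnboundedOperators.heatKernel σ (x-y) / (8*σ^3)) * (inner ℝ (x-y) (u τ y) * inner ℝ (x-y) (u τ y)))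 • (x-y))) ∧ Literature.Analysis.FluidPDE.HasTypeITimeDecay C u ∧ (∀ (x₀ : EuclideanSpace ℝ (Fin 3)) (t₀ r : ℝ), t₀ ≤ 0 → 0 < r → (∀ t, t₀ - r^2 < t → t < t₀ → r⁻¹ * ∫ x in Metric.ball x₀ r, ‖u t x‖^2 ≤ C) ∧ r⁻¹ * ∫ t in Set.Ioo (t₀ - r^2) t₀, ∫ x in Metric.ball x₀ r, ‖fderiv ℝ (u t) x‖^2 ≤ C) → (∀ t < 0, ∀ x, (∃ v w : EuclideanSpace ℝ (Fin 3), ‖v‖ = 1 ∧ ‖w‖ = 1 ∧ inner ℝ v w = 0 ∧ ∀ α β : ℝ, (-t) * inner ℝ (fderiv ℝ (u t) x (α • v + β • w)) (α • v + β • w) ≤ a * (α^2 + β^2))) → ∀ t < 0, ∀ x, u t x = 0)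
    {C m : ℝ} {u : ℝ → EuclideanSpace ℝ (Fin 3) → EuclideanSpace ℝ (Fin 3)} {t₀ : ℝ} {x₀ : EuclideanSpace ℝ (Fin 3)} (ht₀ : t₀ < 0)
    (hu : ContDiffOn ℝ (⊤ : ℕ∞) (Function.uncurry u) (Set.Iio 0 ×ˢ Set.univ) ∧ (∀ t < 0, Literature.Analysis.FluidPDE.VectorCalculus.IsDivFree (u t)) ∧ (∀ s t : ℝ, s < t → t < 0 → ∀ x, u t x = Literature.Analysis.FluidPDE.heatFlow (u s) (t-s) x - ∫ τ in Set.Ioo s t, ∫ y, ((-(inner ℝ (x-y) (u τ y) / (2*(t-τ)) * Literature.Analysis.UnboundedOperators.heatKernel (t-τ) (x-y))) • u τ y + (∫ σ in Set.Ioi (t-τ), Literature.Analysis.UnboundedOperators.heatKernel σ (x-y) / (4*σ^2)) • (inner ℝ (x-y) (u τ y) • u τ y + inner ℝ (u τ y) (u τ y) • (x-y) + inner ℝ (x-y) (u τ y) • u τ y) - ((∫ σ in Set.Ioi (t-τ), Literature.Analysis.UnboundedOperators.heatKernel σ (x-y) / (8*σ^3)) * (inner ℝ (x-y) (u τ y)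 * inner ℝ (x-y) (u τ y))) • (x-y))) ∧ Literature.Analysis.FluidPDE.HasTypeITimeDecay C u ∧ (∀ (x₀ : EuclideanSpace ℝ (Fin 3)) (t₀ r : ℝ), t₀ ≤ 0 → 0 < r → (∀ t, t₀ - r^2 < t → t < t₀ → r⁻¹ * ∫ x in Metric.ball x₀ r, ‖u t x‖^2 ≤ C) ∧ r⁻¹ * ∫ t in Set.Ioo (t₀ - r^2) t₀, ∫ x in Metric.ball x₀ r, ‖fderiv ℝ (u t) x‖^2 ≤ C))
    (hGE : ∃ v w : EuclideanSpace ℝ (Fin 3), ‖v‖ = 1 ∧ ‖w‖ = 1 ∧ inner ℝ v w = 0 ∧ ∀ α β : ℝ, m * (α^2 + β^2) ≤ (-t₀) * inner ℝ (fderiv ℝ (u t₀) x₀ (α • v + β • w)) (α • v + β • w))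
    (hmax : ∀ v' : ℝ → EuclideanSpace ℝ (Fin 3) → EuclideanSpace ℝ (Fin 3), ContDiffOn ℝ (⊤ : ℕ∞) (Function.uncurry v') (Set.Iio 0 ×ˢ Set.univ) ∧ (∀ t < 0, Literature.Analysis.FluidPDE.VectorCalculus.IsDivFree (v' t)) ∧ (∀ s t : ℝ, s < t → t < 0 → ∀ x, v' t x = Literature.Analysis.FluidPDE.heatFlow (v' s) (t-s) x - ∫ τ in Set.Ioo s t, ∫ y, ((-(inner ℝ (x-y) (v' τ y) / (2*(t-τ)) * Literature.Analysis.UnboundedOperators.heatKernel (t-τ) (x-y))) • v' τ y + (∫ σ in Set.Ioi (t-τ), Literature.Analysis.UnboundedOperators.heatKernel σ (x-y) / (4*σ^2)) • (inner ℝ (x-y) (v' τ y) • v' τ y + inner ℝ (v' τ y) (v' τ y) • (x-y) + inner ℝ (x-y) (v' τ y) • v' τ y) - ((∫ σ in Set.Ioi (t-τ), Literature.Analysis.UnboundedOperators.heatKernel σ (x-y) / (8*σ^3)) * (inner ℝ (x-y) (v' τ y) * inner ℝ (x-y) (v' τ y))) • (x-y))) ∧ Literature.Analysis.FluidPDE.HasTypeITimeDecay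 C v' ∧ (∀ (x₀ : EuclideanSpace ℝ (Fin 3)) (t₀ r : ℝ), t₀ ≤ 0 → 0 < r → (∀ t, t₀ - r^2 < t → t < t₀ → r⁻¹ * ∫ x in Metric.ball x₀ r, ‖v' t x‖^2 ≤ C) ∧ r⁻¹ * ∫ t in Set.Ioo (t₀ - r^2) t₀, ∫ x in Metric.ball x₀ r, ‖fderiv ℝ (v' t) x‖^2 ≤ C) → ∀ t < 0, ∀ x, (∃ v w : EuclideanSpace ℝ (Fin 3), ‖v‖ = 1 ∧ ‖w‖ = 1 ∧ inner ℝ v w = 0 ∧ ∀ α β : ℝ, (-t) * inner ℝ (fderiv ℝ (v' t) x (α • v + β • w)) (α • v + β • w) ≤ m * (α^2 + β^2))) :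
    m ≤ 0 ∨ 1 / 4 ≤ m := by
  by_cases hm4 : m < 1 / 4
  · left
    have hz : ∀ x, u t₀ x = 0 := fun x => hMS m hm4 C u hu (hmax u hu) t₀ ht₀ x
    exact nonpos_of_twoFrame_lower_of_slice_zero hz hGE
  · right
    exact not_lt.1 hm4

/-- **The quarter form of the crux.** Given the `MustSqueeze` family below `1/4`, the crux is
equivalent to the pointwise a-priori bound "`Λ_u(t,x) < 1/4` at every point of every element of
every `𝒦_C`" (`crux_iff_forall_lerayMiddleStrain_lt` for `⇒`; for `⇐`, an attained maximum is
then `< 1/4` and the tree's `extremalBiaxialitySubcritical_bootstrap` concludes). The threshold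
`1/8` of the route carries no content. [folklore] -/
theorem crux_iff_forall_lerayMiddleStrain_lt_quarter
    (hMS : ∀ a : ℝ, a < 1 / 4 → ∀ (C : ℝ) (u : ℝ → EuclideanSpace ℝ (Fin 3) → EuclideanSpace ℝ (Fin 3)), ContDiffOn ℝ (⊤ : ℕ∞) (Function.uncurry u) (Set.Iio 0 ×ˢ Set.univ) ∧ (∀ t < 0, Literature.Analysis.FluidPDE.VectorCalculus.IsDivFree (u t)) ∧ (∀ s t : ℝ, s < t → t < 0 → ∀ x, u t x = Literature.Analysis.FluidPDE.heatFlow (u s) (t-s) x - ∫ τ in Set.Ioo s t, ∫ y, ((-(inner ℝ (x-y) (u τ y) / (2*(t-τ)) * Literature.Analysis.UnboundedOperators.heatKernel (t-τ) (x-y))) • u τ y + (∫ σ in Set.Ioi (t-τ), Literature.Analysis.UnboundedOperators.heatKernel σ (x-y) / (4*σ^2)) • (inner ℝ (x-y) (u τ y) • u τ y + inner ℝ (u τ y) (u τ y) • (x-y) + inner ℝ (x-y) (u τ y) • u τ y) - ((∫ σ in Set.Ioi (t-τ), Literature.Analysis.UnboundedOperators.heatKernel σ (x-y) / (8*σ^3))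 * (inner ℝ (x-y) (u τ y) * inner ℝ (x-y) (u τ y))) • (x-y))) ∧ Literature.Analysis.FluidPDE.HasTypeITimeDecay C u ∧ (∀ (x₀ : EuclideanSpace ℝ (Fin 3)) (t₀ r : ℝ), t₀ ≤ 0 → 0 < r → (∀ t, t₀ - r^2 < t → t < t₀ → r⁻¹ * ∫ x in Metric.ball x₀ r, ‖u t x‖^2 ≤ C) ∧ r⁻¹ * ∫ t in Set.Ioo (t₀ - r^2) t₀, ∫ x in Metric.ball x₀ r, ‖fderiv ℝ (u t) x‖^2 ≤ C) → (∀ t < 0, ∀ x, (∃ v w : EuclideanSpace ℝ (Fin 3), ‖v‖ = 1 ∧ ‖w‖ = 1 ∧ inner ℝ v w = 0 ∧ ∀ α β : ℝ, (-t) * inner ℝ (fderiv ℝ (u t) x (α • v + β • w)) (α • v + β • w) ≤ a * (α^2 + β^2))) → ∀ t < 0, ∀ x, u t x = 0) :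
    SqueezeCycle.ExtremalBiaxialitySubcritical ↔
      ∀ (C : ℝ) (u : ℝ → EuclideanSpace ℝ (Fin 3) → EuclideanSpace ℝ (Fin 3)), (ContDiffOn ℝ (⊤ : ℕ∞) (Function.uncurry u) (Set.Iio 0 ×ˢ Set.univ) ∧ (∀ t < 0, Literature.Analysis.FluidPDE.VectorCalculus.IsDivFree (u t)) ∧ (∀ s t : ℝ, s < t → t < 0 → ∀ x, u t x = Literature.Analysis.FluidPDE.heatFlow (u s) (t-s) x - ∫ τ in Set.Ioo s t, ∫ y, ((-(inner ℝ (x-y) (u τ y) / (2*(t-τ)) * Literature.Analysis.UnboundedOperators.heatKernel (t-τ) (x-y))) • u τ y + (∫ σ in Set.Ioi (t-τ), Literature.Analysis.UnboundedOperators.heatKernel σ (x-y) / (4*σ^2)) • (inner ℝ (x-y) (u τ y) • u τ y + inner ℝ (u τ y) (u τ y) • (x-y) + inner ℝ (x-y) (u τ y) • u τ y) - ((∫ σ in Set.Ioi (t-τ), Literature.Analysis.UnboundedOperators.heatKernel σ (x-y) / (8*σ^3)) * (inner ℝ (x-y) (u τ y) * inner ℝ (x-y) (u τ y))) • (x-y)))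 ∧ Literature.Analysis.FluidPDE.HasTypeITimeDecay C u ∧ (∀ (x₀ : EuclideanSpace ℝ (Fin 3)) (t₀ r : ℝ), t₀ ≤ 0 → 0 < r → (∀ t, t₀ - r^2 < t → t < t₀ → r⁻¹ * ∫ x in Metric.ball x₀ r, ‖u t x‖^2 ≤ C) ∧ r⁻¹ * ∫ t in Set.Ioo (t₀ - r^2) t₀, ∫ x in Metric.ball x₀ r, ‖fderiv ℝ (u t) x‖^2 ≤ C)) →
        ∀ t < 0, ∀ x, lerayMiddleStrain u t x < 1 / 4 := by
  constructor
  · intro hX C u hu t ht x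
    exact (lerayMiddleStrain_lt_of_crux hX hu ht x).trans (by norm_num)
  · intro h
    refine extremalBiaxialitySubcritical_bootstrap hMS fun C m u t₀ x₀ ht₀ hu hGE _ => ?_
    exact lt_of_le_of_lt ((le_lerayMiddleStrain_iff ht₀ m).2 hGE) (h C u hu t₀ ht₀ x₀)

end Summit.NavierStokesRegularity.NavierStokesRegularity.Theorems.ExtremalBiaxialitySubcritical.Negative

end
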